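import Summits.CriticalPhenomena.PercolationContinuityZ3.Theorems.Transplant.GrigorchukSubexponentialGrowthAllGens
import Summits.CriticalPhenomena.PercolationContinuityZ3.Theorems.Transplant.StatementPolynomialGrowth
import HarnessLib

/-!
# EVERY CAYLEY GRAPH OF THE FIRST GRIGORCHUK GROUP lies inside the scope of the open residue node `BenjaminiSchramm1996_conj4_amenableSubexponential`
# — the node (a HYPOTHESIS here) would give `θ(p_c) = 0` on every `Cay(𝔊; S)`; all five of its hypotheses are kernel theorems there

builds on p205010 (kernel theorem, internal audit signed; external expert review pending) — nothing in this file uses p205010.  Lane `prim-bschramm`, seat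
`prim-bschramm-gen-1` gen 9 (GEN pen; offer O-BE5, the `𝔊`-twin of F-BE3's §4/§5 scope theorem).  DEF-FREE helper file (`--supports stmt-CriticalPhenomena-4575 --as helper`);
no instance, no notation, no `@[conjecture]` declared or asserted.  CUSTOMER ONLY: the residue node `BenjaminiSchramm1996_conj4_amenableSubexponential` («StatementPolynomialGrowth»
:76, OPEN in print and in the tree) is taken as a HYPOTHESIS binder and applied literally to the five kernel theorems for `Cay(𝔊; S)`, `S` finite generating: connected and
quasi-transitive («CayleyMilnorKernel»), amenable and NOT of exponential growth («GrigorchukSubexponentialGrowthAllGens» p613200: `isGraphAmenable_cayley_gens`,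
`not_hasExponentialGrowth_cayley_gens` — Grigorchuk 1984, kernel), `p_c < 1` («GrigorchukCriticalProbLtOne» p607347: `grigorchukGroup_criticalProb_lt_one` — Muchnik–Pak, kernel).
MUST-NOT: `θ(p_c)` on `Cay(𝔊; S)` is NOT proved in tree or print; the residue node stays OPEN ('would follow IF'); Hutchcroft 2016's growth hypothesis FAILS there (nothing refuted);
the polynomial-growth node does not APPLY (p619845); nothing about `BenjaminiSchramm1996_conj4_endState`; no growth exponent.
[cite: BenjaminiSchramm1996, Conj. 4] [cite: HermonHutchcroft2021, §1 (the open regime)] [cite: Grigorchuk1984, Thm.] [cite: MuchnikPak2001, Thm. 1]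
-/

noncomputable section

namespace Summit.CriticalPhenomena.PercolationContinuityZ3.Theorems.Transplant
namespace Grigorchuk

open SimpleGraph Literature.Barriers.CriticalPhenomena Literature.Probability.Percolation Literature.Probability.LatticeModels
open scoped Classical

/-- **SCOPE OF THE RESIDUE NODE FOR `𝔊`: on every Cayley graph `Cay(𝔊; S)` (`S` finite generating) the open residue node — a HYPOTHESIS, never asserted — would give
`θ_g(p_c) = 0` at every vertex**; its five hypotheses are the kernel theorems `connected_mulCayley_of_closure`, `isQuasiTransitive_mulCayley`, `isGraphAmenable_cayley_gens`,
`not_hasExponentialGrowth_cayley_gens`, `grigorchukGroup_criticalProb_lt_one`.  `θ(p_c)` itself is NOT proved. [cite: BenjaminiSchramm1996, Conj. 4] [cite: HermonHutchcroft2021, §1] -/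
theorem grigorchuk_cayley_gens_theta_eq_zero_of_conj4_amenableSubexponential (h : BenjaminiSchramm1996_conj4_amenableSubexponential)
    (S : Finset ↥grigorchukGroup) (hS : Subgroup.closure (↑S : Set ↥grigorchukGroup) = ⊤) (g : ↥grigorchukGroup) :
    theta (mulCayley (↑S : Set ↥grigorchukGroup)) g (criticalProbIOf (mulCayley (↑S : Set ↥grigorchukGroup)) g) = 0 :=
  h _ (CayleyScaled.connected_mulCayley_of_closure S hS) (CayleyScaled.isQuasiTransitive_mulCayley S) (isGraphAmenable_cayley_gens S)
    (not_hasExponentialGrowth_cayley_gens S) g (grigorchukGroup_criticalProb_lt_one S hS g)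

/-- **… in particular on the standard Cayley graph `Cay(𝔊; a, b, c, d)`.** [cite: BenjaminiSchramm1996, Conj. 4] [cite: Grigorchuk1984, Thm.] -/
theorem grigorchuk_cayley_theta_eq_zero_of_conj4_amenableSubexponential (h : BenjaminiSchramm1996_conj4_amenableSubexponential) (g : ↥grigorchukGroup) :
    theta (mulCayley (↑({aG, bG, cG, dG} : Finset ↥grigorchukGroup) : Set ↥grigorchukGroup)) g
      (criticalProbIOf (mulCayley (↑({aG, bG, cG, dG} : Finset ↥grigorchukGroup) : Set ↥grigorchukGroup)) g) = 0 :=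
  grigorchuk_cayley_gens_theta_eq_zero_of_conj4_amenableSubexponential h _ closure_gens_finset g

end Grigorchuk
end Summit.CriticalPhenomena.PercolationContinuityZ3.Theorems.Transplant
end
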